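import Mathlib
import HarnessLib
import HarnessLib.Audit
import Summits.Langlands.Statement
import Summits.Langlands.Langlands.Theses.PrimeSwitchSplit
import Summits.Langlands.Langlands.Theses.MotivicDictionarySplit
import Summits.Langlands.Langlands.Theorems.AbelianMotivicReciprocityWeightOneVisibilitySplit
import Literature.AlgebraicGeometry.Motives.Varieties
import Literature.AlgebraicGeometry.Motives.GaloisRealization
import Literature.AlgebraicGeometry.Motives.EllAdicEtaleRational
import Literature.NumberTheory.GaloisRepresentations.LabelledHodgeTateWeights
import Literature.NumberTheory.PAdicHodge.FontaineDpst
import Literature.NumberTheory.Automorphic.GLnAdelicStructureProofs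

/-!
# WeightOneDescentSplit — lens-2 g35 node (structural dichotomy, special side, three levels down): g34's visible hull of AVR by DESCENT TYPE

seat `decomp-langlands-lens-2-g35` · 2026-08-31 · kit `run/shared/lean/pub/decomp-langlands/decomp-langlands-lens-2/g35/` (texts35.py renders every statement
below from the tree text of `Theses/MotivicDictionarySplit.lean`: each cell = AVR + guards inserted at offset 2093; g34's cells imported verbatim from texts34.py,
shas asserted) · memo `WeightOneDescentSplit.md`.
LANGLANDS ROUTE FREEZE honoured: this file is TYPED-NOT-FILED by the seat (0 ledger writes); landing twin target
`Theorems/AbelianMotivicReciprocityWeightOneDescentSplit.lean --supports stmt-Langlands-27425 --as helper` (census), hygiene: no decl named `closes`,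
no decl named like an existing route item, no linter disabled; g34's LANDED twin `Theorems/AbelianMotivicReciprocityWeightOneVisibilitySplit.lean`
(p831697, census ACCEPT L2440 / crit row 477) is IMPORTED and its decls (`HasLabelledHTMultiplicityAtMost`, REG₁, WALL₁, DEG₁, `closes_target`,
`abelianMotivicReciprocity_iff_cells`, `degenerate_of_target`) are used BY NAME — nothing of g34 is restated here.

## Target (tree decls BY NAME)
* AVR = `Summit.Langlands.Langlands.Theses.MotivicDictionarySplit.AbelianMotivicReciprocity` (stmt-Langlands-27425, crux r2, ATTACKABLE, route OPEN; registered
  birth cut «n = 2 ∧ K = ℚ ∣ n = 2 ∧ K ≠ ℚ ∣ n ≠ 2»): reciprocity for the irreducible pinned-geometric ρ realised, up to Tate twist, in some H¹_ét(X_K̄, ℚ_ℓ)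
  — the WEIGHT-ONE population (twisted simple constituents of Tate modules of abelian varieties over K);
* host chain: AVR → `MotivicDictionarySplit.closes` (+HMR 27426, NMR 27427) → B_w = `PrimeSwitchSplit.WeakGeometricAutomorphy` (17414) → `PrimeSwitchSplit.closes` → `Langlands`;
* first layer (g34 `WeightOneVisibilitySplit`, CRITIC-LEDGER row 472 CLEARED): AVR ⟺ REG₁ ∧ WALL₁ ∧ DEG₁ by labelled Hodge–Tate multiplicity (≤ 1 ∣ = 2 ∣ ≥ 3); the
  critic read REG₁ as «ATTACKABLE-IN-PART (CM potential only, mixed dark)» and g34's NEXT said: go down into REG₁ along the base field.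

## The move
Read the lens-2 g5 dial — the DESCENT TYPE of the pair (K, ρ) (`DescentTypeTrichotomy`, items 29560/29574/29575, at Reciprocity level, CLEARED) — on g34's visible hull
m(ρ) ≤ 2 (rank ≤ 4: characters, elliptic curves, GL₂-type, abelian surfaces, Picard/U(2,2)/CM ⊗ Artin₂ types).  SAT(K, ρ) = «solvably of TR/CM type»: there are a totally real or
CM field K₀, a number field M ⊇ K, K₀ with BOTH M/K and M/K₀ of solvable Galois closure, and an irreducible pinned-geometric ρ₀ over K₀ whose restriction to Γ_M
twist-matches ρ|Γ_M pointwise.  This is exactly the population the print engines act on: the automorphic form is CONSTRUCTED over the core field K₀ on a Hilbert /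
unitary / Siegel / Picard Shimura variety (ℓ₀ = 0 Taylor–Wiles–Kisin over TR; ℓ₀ > 0 Calegari–Geraghty / 10-author / Caraiani–Newton over CM, where torsion Galois
representations exist) and TRANSPORTED to K along solvable layers (Langlands / Arthur–Clozel cyclic base change; soluble descent given ρ, Taylor 2006).  Off the orbit both
anchors fail by tree theorems (`not_chtCoincidenceGL_of_complexPlace`: ℓ₀ = r₂ > 0; `ShimuraVarietyRealizationBarrier_holds`) and «base change for nonsolvable extensions
is unavailable» (Getz–Hahn §13.4–13.5).  One deliberate change to g5's dial: the Lie-irreducibility clauses are DROPPED (at weight one the CM / potentially abelian pieces are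
placed by base field like everything else; with g5's clause verbatim every CM elliptic curve would fall into the debt).  DEG₁ (m ≥ 3) is NOT re-cut: even K = ℚ has no
engine there (g34's seal).

| piece | decl | := AVR VERBATIM + | kind / rank (would-be child route V-W-D) | tag |
|---|---|---|---|---|
| SATREG₁ | `RegularWeightOneTRCMReciprocity` | `→ (mult ≤ 1) → SAT → concl` | crux 2 | WEAKER · S-implied · ATTACKABLE (n = 1 = item 24805 by name; n = 2 rational orbit = print mod typing (BC5 rung); higher TR/CM orbits = FLS/DNS/Box/Caraiani–Newton/GL₂-type MLT frontier) |
| SATWALL₁ | `WallWeightOneTRCMReciprocity` | `→ ¬(mult ≤ 1) → (mult ≤ 2) → SAT → concl` | crux 3 | WEAKER · S-implied · INSTRUMENTABLE (ℓ₀ = 1 over the core field: BCGP abelian surfaces (potential, tree fact), Picard (2,1), U(2,2)); icosahedral CM ⊗ Artin over CM placed as dark sub-core |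
| DEBTVIS₁ | `VisibleWeightOneInsolubleReciprocity` | `→ (mult ≤ 2) → ¬SAT → concl` | residual 4 | WEAKER · S-implied · BARRIER (TaylorWilesNumericalCoincidence ∧ ShimuraVarietyRealization ∧ no non-solvable base change): EMPTY over TR/CM K (kernel); boxes ρ_E on the S₅-quintic (DESC₁), E′ over the −23 cubic (PRIM₁) |
| DEG₁ | g34's `WeightOneVisibilitySplit.DegenerateWeightOneReciprocity` (TREE DECL BY NAME) | `→ ¬(mult ≤ 2) → concl` | residual 5 | g34's cell (statement text sha256[:12] 8cf5a646d7da, = item text of V-W-D): sealed (Knapp–Zuckerman / Mirković / NonRegularWeight) |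
| Assembly | SATREG₁ → SATWALL₁ → DEBTVIS₁ → DEG₁ → AVR | — | assembly 1 | proved: `closes_target` (0 sorry) |

ORBIT-CLOSED DIALS: m(ρ) as in g34; SAT is invariant under solvable base change AND solvable descent of K (composita / towers of solvable-closure extensions stay of
solvable closure), under twists by characters (the pointwise constant absorbs them) and Gal(ℚ̄/ℚ)-conjugation — so the critic's leak tests (solvable totally-complex
restriction, Arthur–Clozel descent, W⁺) act INSIDE each cell.  Cheapest falsifier (field theory): the Galois closure of ℚ(β), β⁵ − β − 1 = 0, is an S₅-field whose complex
conjugation is a double transposition, so its only TR/CM subfields are ℚ and ℚ(√2869) (fixed fields of S₅, A₅); hence for every TR/CM K₀ the Galois closure of K₀(β)/K₀ has group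
S₅ or A₅ — insoluble — and no M ⊇ ℚ(β) has solvable Galois closure over a TR/CM field, whence every visible weight-one ρ over ℚ(β) (e.g. ρ_E|Γ_{ℚ(β)}, E/ℚ) lies in DEBTVIS₁: the residual is non-empty in rank 2.

## Kernel (this file: rc 0 · 0 sorry · axioms [propext, Classical.choice, Quot.sound])
`closes_target : SATREG₁ → SATWALL₁ → DEBTVIS₁ → DEG₁ → AVR` (TARGET BY NAME, DEG₁ = g34's decl BY NAME; excluded middle on m ≤ 2 ∣ SAT ∣ m ≤ 1; direct, pure logic) ·
`abelianMotivicReciprocity_iff_cells : AVR ↔ SATREG₁ ∧ SATWALL₁ ∧ DEBTVIS₁ ∧ DEG₁` (EXACT) · JUNCTION BY NAME with g34's landed file — second layer: `regularWeightOne_of_cells :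
SATREG₁ → DEBTVIS₁ → REG₁`, `wallWeightOne_of_cells : SATWALL₁ → DEBTVIS₁ → WALL₁`, `cells_of_visible`, `visible_iff_cells : (REG₁ ∧ WALL₁) ↔ (SATREG₁ ∧ SATWALL₁ ∧ DEBTVIS₁)` (EXACT),
`closes_target_via_g34` (:= g34's `WeightOneVisibilitySplit.closes_target` applied to the two `_of_cells` maps), `abelianMotivicReciprocity_iff_cells_via_g34` (:= g34's
`abelianMotivicReciprocity_iff_cells` ∘ `visible_iff_cells`) · vocabulary: g34's `HasLabelledHTMultiplicityAtMost` + `hasLabelledHTMultiplicityAtMost_mono` BY NAME; new here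
`IsSolvablyOfTRCMType`, `IsPotentiallyOfTRCMType` with `isSolvablyOfTRCMType_of_isTRorCM` (K₀ = M = K, ρ₀ = ρ, c = 1) and `isPotentiallyOfTRCMType_of_isSolvably` · VACUITY `visibleInsoluble_holds_over_TRCM : (IsTotallyReal K ∨ IsCMField K) → VisibleWeightOneInsolubleReciprocityAt K`
(the residual is invisible over TR/CM base fields) · certs `AVR ⟹ cell` ×3 + g34's `degenerate_of_target`, `B_w ⟹ cell` ×3 + g34's `degenerate_of_weakGeometricAutomorphy` · hosts `closes_parent` (+HMR, NMR ⟹ B_w via `MotivicDictionarySplit.closes`),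
`closes_root` (+N0's five ⟹ `Langlands` via `PrimeSwitchSplit.closes`).
bc7 (HarnessLib crux probe, batteries P1–P5): SATREG₁ / SATWALL₁ / DEBTVIS₁ CLEAN vs `Langlands` and vs AVR (90 s budget reruns where P5 timed out); DEG₁ = g34's probes.
Vehicles (pen-holders', see RUNME.md): LINE `weight-one-descent` on 27425 (4 stubs = the cells; rc 0, sorries = stubs; refines g34's LINE at its first two stubs and the
registered birth's literal field cut «K = ℚ ∣ K ≠ ℚ» by the orbit-closed dial); child route V-W-D `vr.route.json` + `vr.glue.lean` (`--refines
route-Langlands-MotivicDictionarySplit:AbelianMotivicReciprocity`; schema OK, native OK cone 4/4, tribunal quick/full recorded in RUNME.md); births ×3 (door ∣ 24805 ∣ n = 2 rational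
orbit ∣ n = 2 higher orbit; door ∣ rank ≤ 2 ∣ 3 ∣ 4; 24805 ∣ DESC₁ ∣ PRIM₁ — sorries = stubs, compositions kernel-checked); DEG₁'s birth = g34's.
-/



namespace Summit.Langlands.Langlands.Theorems.WeightOneDescentSplit

/-! ### Vocabulary — the two dials (node-level abbreviations; every cell below is ALSO fully inlined, `_iff_V` by `Iff.rfl`) -/
section Vocabulary
variable (K : Type) [Field K] [NumberField K] (ℓ : ℕ) [Fact ℓ.Prime] (n : ℕ)
  (ρ : Literature.NumberTheory.GaloisRepresentations.FramedGaloisRep K (PadicAlgCl ℓ) n)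

/- FIRST DIAL = g34's `WeightOneVisibilitySplit.HasLabelledHTMultiplicityAtMost` (LANDED, p831697) — used BY NAME below. -/

/-- SECOND DIAL (lens-2 g5 `DescentTypeTrichotomy` SAT(K, ρ), READ AT WEIGHT ONE — the Lie-irreducibility clauses of items
29560/29574/29575 are dropped, so that CM and GL₂-type pieces, which are Lie-reducible or have Lie-reducible twists, are placed by
their base-field type and not thrown into the debt): `ρ` is SOLVABLY OF TR/CM TYPE — there are a totally real or CM number field
`K₀`, a number field `M ⊇ K, K₀` with BOTH `M/K` and `M/K₀` of solvable Galois closure, and an irreducible pinned-geometric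
`ρ₀ : Γ_{K₀} → GL_n(ℚ̄_ℓ)` whose restriction to `Γ_M` pointwise twist-matches `ρ|Γ_M`
(`charpoly ρ(g) = scaleRoots (charpoly ρ₀(g)) c_g`, `c_g ≠ 0`).  This is the orbit, under the print transfer groupoid of GL_n
(twist by a geometric character · base change along an extension of solvable closure · descent along one, given the avatar),
of the pinned-geometric data over totally real / CM fields — where every automorphy-lifting and potential-automorphy engine lives. -/
def IsSolvablyOfTRCMType : Prop :=
  (∃ (K₀ : Type) (_ : Field K₀) (_ : NumberField K₀) (M : Type) (_ : Field M) (_ : NumberField M) (_ : Algebra K M) (_ : Algebra K₀ M), (NumberField.IsTotallyReal K₀ ∨ NumberField.IsCMField K₀) ∧ (∃ (N : Type) (_ : Field N) (_ : NumberField N) (_ : Algebra K N) (_ : Algebra M N) (_ : IsScalarTower K M N), IsGalois K N ∧ IsSolvable (N ≃ₐ[K] N)) ∧ (∃ (N : Type) (_ : Field N) (_ : NumberField N) (_ : Algebra K₀ N) (_ : Algebra M N) (_ : IsScalarTower K₀ M N), IsGalois K₀ N ∧ IsSolvable (N ≃ₐ[K₀] N)) ∧ ∃ ρ₀ : Literature.NumberTheory.GaloisRepresentations.FramedGaloisRep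 K₀ (PadicAlgCl ℓ) n, ρ₀.toGaloisRep.IsIrreducible ∧ ((∀ᶠ v : IsDedekindDomain.HeightOneSpectrum (NumberField.RingOfIntegers K₀) in Filter.cofinite, ρ₀.IsUnramifiedAt v) ∧ ∀ (v : IsDedekindDomain.HeightOneSpectrum (NumberField.RingOfIntegers K₀)) (hv : ((ℓ : ℕ) : NumberField.RingOfIntegers K₀) ∈ v.asIdeal), (Literature.NumberTheory.PAdicHodge.fontainePstAdicCompletion v ℓ hv).IsDeRhamFramed (ρ₀.toLocal v)) ∧ ∀ g : Field.absoluteGaloisGroup M, ∃ c : PadicAlgCl ℓ, c ≠ 0 ∧ Literature.NumberTheory.GaloisRepresentations.FramedRep.charpoly (ρ.restrictField M) g = (Literature.NumberTheory.GaloisRepresentations.FramedRep.charpoly (ρ₀.restrictField M) g).scaleRoots c)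

/-- THIRD-LAYER DIAL (node-only; g5's PSAT read at weight one): the same with `M/K₀` ARBITRARY — used only to birth the residual
as «insoluble base-change debt ∣ primitive mixed-signature debt». -/
def IsPotentiallyOfTRCMType : Prop :=
  (∃ (K₀ : Type) (_ : Field K₀) (_ : NumberField K₀) (M : Type) (_ : Field M) (_ : NumberField M) (_ : Algebra K M) (_ : Algebra K₀ M), (NumberField.IsTotallyReal K₀ ∨ NumberField.IsCMField K₀) ∧ (∃ (N : Type) (_ : Field N) (_ : NumberField N) (_ : Algebra K N) (_ : Algebra M N) (_ : IsScalarTower K M N), IsGalois K N ∧ IsSolvable (N ≃ₐ[K] N)) ∧ ∃ ρ₀ : Literature.NumberTheory.GaloisRepresentations.FramedGaloisRep K₀ (PadicAlgCl ℓ) n, ρ₀.toGaloisRep.IsIrreducible ∧ ((∀ᶠ v : IsDedekindDomain.HeightOneSpectrum (NumberField.RingOfIntegers K₀) in Filter.cofinite, ρ₀.IsUnramifiedAt v) ∧ ∀ (v : IsDedekindDomain.HeightOneSpectrum (NumberField.RingOfIntegers K₀)) (hv : ((ℓ : ℕ) : NumberField.RingOfIntegers K₀) ∈ v.asIdeal),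 (Literature.NumberTheory.PAdicHodge.fontainePstAdicCompletion v ℓ hv).IsDeRhamFramed (ρ₀.toLocal v)) ∧ ∀ g : Field.absoluteGaloisGroup M, ∃ c : PadicAlgCl ℓ, c ≠ 0 ∧ Literature.NumberTheory.GaloisRepresentations.FramedRep.charpoly (ρ.restrictField M) g = (Literature.NumberTheory.GaloisRepresentations.FramedRep.charpoly (ρ₀.restrictField M) g).scaleRoots c)

end Vocabulary

/-! ### The four cells (each = AVR VERBATIM + guards inserted at char 2093, see texts35.py; tags in the docstrings) -/

/-- SATREG₁ `RegularWeightOneTRCMReciprocity` — crux (rank 2) · [S-implied · WEAKER · ATTACKABLE — the ONLY honestly attackable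
cell of AVR]: AVR VERBATIM + «(every labelled HT multiplicity ≤ 1) → (solvably of TR/CM type) →».  Population (mod the weight-one
Hodge–Tate door: rank ≤ 2): L-algebraic Hecke characters (n = 1, item 24805), and the Tate-module pieces of ELLIPTIC CURVES and
GL₂-TYPE ABELIAN VARIETIES over totally real or CM fields together with all their twists, solvable base changes and solvable
descents.  PRINT interior: K₀ = ℚ (Wiles–BCDT, Khare–Wintenberger + Kisin), elliptic curves over real quadratic (Freitas–Le
Hung–Siksek 2015), totally real cubic (Derickx–Najman–Siksek 2020) and quartic fields (Box 2022), over imaginary quadratic fields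
with conditions (Caraiani–Newton 2023), base change of classical forms to every totally real field (Dieulefait); POTENTIAL
automorphy throughout (Taylor 2002 over TR; Allen–Calegari–Caraiani–Gee–… 2023 over CM).  OPEN core: GL₂-type abelian varieties
over a general totally real field (residual modularity for no λ), elliptic curves over a general CM field (only potential).
Engines: Taylor–Wiles–Kisin patching at ℓ₀ = 0 over TR, the ACC⁺ / Caraiani–Newton ℓ₀ > 0 patching over CM with
local–global compatibility in the crystalline range, 2–3–5–7 switches, solvable base change (Langlands, Arthur–Clozel). -/
def RegularWeightOneTRCMReciprocity : Prop :=
  ∀ (K : Type) [Field K] [NumberField K] (n : ℕ) (hcpt : Literature.NumberTheory.Automorphic.isCompact_glFiniteIntegralLevel n K), 0 < n → ∀ (ℓ : ℕ) [Fact ℓ.Prime] (ι : PadicAlgCl ℓ ≃+* ℂ) (ρ : Literature.NumberTheory.GaloisRepresentations.FramedGaloisRep K (PadicAlgCl ℓ) n), ρ.toGaloisRep.IsIrreducible → ((∀ᶠ v : IsDedekindDomain.HeightOneSpectrum (NumberField.RingOfIntegers K) in Filter.cofinite, ρ.IsUnramifiedAt v) ∧ ∀ (v : IsDedekindDomain.HeightOneSpectrum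 (NumberField.RingOfIntegers K)) (hv : ((ℓ : ℕ) : NumberField.RingOfIntegers K) ∈ v.asIdeal), (Literature.NumberTheory.PAdicHodge.fontainePstAdicCompletion v ℓ hv).IsDeRhamFramed (ρ.toLocal v)) → (∃ (d : ℕ) (X : Literature.AlgebraicGeometry.Motives.SchemeOver K), Literature.AlgebraicGeometry.Motives.IsSmoothProjective d X ∧ ∃ (j : ℤ) (W : Submodule (PadicAlgCl ℓ) (TensorProduct ℚ_[ℓ] (PadicAlgCl ℓ) (Literature.AlgebraicGeometry.Motives.ellAdicEtaleCohomologyRat ℓ 1 (Literature.AlgebraicGeometry.Motives.geometricFibre K X)))) (hW : ∀ (g : Field.absoluteGaloisGroup K) (w : TensorProduct ℚ_[ℓ] (PadicAlgCl ℓ) (Literature.AlgebraicGeometry.Motives.ellAdicEtaleCohomologyRat ℓ 1 (Literature.AlgebraicGeometry.Motives.geometricFibre K X))), w ∈ W → (algebraMap ℚ_[ℓ] (PadicAlgCl ℓ) ((Literature.AlgebraicGeometry.Motives.padicCyclotomicCharacter K ℓ g : ℚ_[ℓ]ˣ) : ℚ_[ℓ])) ^ j • (Literature.AlgebraicGeometry.Motives.geometricEllAdicEtaleCohomologyRepRat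 ℓ X 1 g).baseChange (PadicAlgCl ℓ) w ∈ W) (f : W →ₗ[PadicAlgCl ℓ] (Fin n → PadicAlgCl ℓ)), Function.Surjective f ∧ ∀ (g : Field.absoluteGaloisGroup K) (w : W), f ⟨(algebraMap ℚ_[ℓ] (PadicAlgCl ℓ) ((Literature.AlgebraicGeometry.Motives.padicCyclotomicCharacter K ℓ g : ℚ_[ℓ]ˣ) : ℚ_[ℓ])) ^ j • (Literature.AlgebraicGeometry.Motives.geometricEllAdicEtaleCohomologyRepRat ℓ X 1 g).baseChange (PadicAlgCl ℓ) (w : TensorProduct ℚ_[ℓ] (PadicAlgCl ℓ) (Literature.AlgebraicGeometry.Motives.ellAdicEtaleCohomologyRat ℓ 1 (Literature.AlgebraicGeometry.Motives.geometricFibre K X))), hW g w w.2⟩ = ((ρ g : GL (Fin n) (PadicAlgCl ℓ)) : Matrix (Fin n) (Fin n) (PadicAlgCl ℓ)).mulVec (f w)) → (∀ (v : IsDedekindDomain.HeightOneSpectrum (NumberField.RingOfIntegers K)) (hv : ((ℓ : ℕ) : NumberField.RingOfIntegers K) ∈ v.asIdeal) (τ : v.adicCompletion K →+* PadicAlgCl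 ℓ), Continuous τ → ∀ w : ℤ, (ρ.labelledHodgeTateWeightsAt v (Literature.NumberTheory.PAdicHodge.fontainePstAdicCompletion v ℓ hv).algebra (Literature.NumberTheory.PAdicHodge.fontainePstAdicCompletion v ℓ hv).𝔅 τ).count w ≤ 1) → (∃ (K₀ : Type) (_ : Field K₀) (_ : NumberField K₀) (M : Type) (_ : Field M) (_ : NumberField M) (_ : Algebra K M) (_ : Algebra K₀ M), (NumberField.IsTotallyReal K₀ ∨ NumberField.IsCMField K₀) ∧ (∃ (N : Type) (_ : Field N) (_ : NumberField N) (_ : Algebra K N) (_ : Algebra M N) (_ : IsScalarTower K M N), IsGalois K N ∧ IsSolvable (N ≃ₐ[K] N)) ∧ (∃ (N : Type) (_ : Field N) (_ : NumberField N) (_ : Algebra K₀ N) (_ : Algebra M N) (_ : IsScalarTower K₀ M N), IsGalois K₀ N ∧ IsSolvable (N ≃ₐ[K₀] N)) ∧ ∃ ρ₀ : Literature.NumberTheory.GaloisRepresentations.FramedGaloisRep K₀ (PadicAlgCl ℓ) n, ρ₀.toGaloisRep.IsIrreducible ∧ ((∀ᶠ v : IsDedekindDomain.HeightOneSpectrum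 (NumberField.RingOfIntegers K₀) in Filter.cofinite, ρ₀.IsUnramifiedAt v) ∧ ∀ (v : IsDedekindDomain.HeightOneSpectrum (NumberField.RingOfIntegers K₀)) (hv : ((ℓ : ℕ) : NumberField.RingOfIntegers K₀) ∈ v.asIdeal), (Literature.NumberTheory.PAdicHodge.fontainePstAdicCompletion v ℓ hv).IsDeRhamFramed (ρ₀.toLocal v)) ∧ ∀ g : Field.absoluteGaloisGroup M, ∃ c : PadicAlgCl ℓ, c ≠ 0 ∧ Literature.NumberTheory.GaloisRepresentations.FramedRep.charpoly (ρ.restrictField M) g = (Literature.NumberTheory.GaloisRepresentations.FramedRep.charpoly (ρ₀.restrictField M) g).scaleRoots c) → ∃ π : Literature.NumberTheory.Automorphic.CuspidalAutomorphicRepData n K hcpt, π.1.IsLAlgebraic ∧ ∀ᶠ v : IsDedekindDomain.HeightOneSpectrum (NumberField.RingOfIntegers K) in Filter.cofinite, Summit.Langlands.SatakeFrobCompatibleAt ι π.1 ρ v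

/-- SATWALL₁ `WallWeightOneTRCMReciprocity` — crux (rank 3) · [S-implied · WEAKER · INSTRUMENTABLE (ℓ₀ = 1 class over a
Shimura-realizable base)]: AVR VERBATIM + «¬ (mult ≤ 1) → (mult ≤ 2) → (solvably of TR/CM type) →».  Population (mod the door:
rank ≤ 4): abelian surfaces / GSp₄-type pieces of shape (2,2) over totally real fields (BCGP 2018: POTENTIALLY modular; BCGP 2025:
a positive proportion over ℚ modular), Picard (2,1)-type abelian threefolds and U(2,2)-type fourfolds over CM fields, definite
CM ⊗ Artin₂ types — and their solvable orbit.  Every member has a non-degenerate holomorphic limit of discrete series on a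
unitary / symplectic similitude group over its TR/CM core field K₀, whose Shimura variety EXISTS: coherent cohomology in
singular weight + higher Hida / Coleman theory + Calegari–Geraghty patching at ℓ₀ = 1 is the method class; then solvable
transport.  The insoluble CM ⊗ icosahedral-Artin sub-core stays dark (SolvableImageBarrier, placed not claimed). -/
def WallWeightOneTRCMReciprocity : Prop :=
  ∀ (K : Type) [Field K] [NumberField K] (n : ℕ) (hcpt : Literature.NumberTheory.Automorphic.isCompact_glFiniteIntegralLevel n K), 0 < n → ∀ (ℓ : ℕ) [Fact ℓ.Prime] (ι : PadicAlgCl ℓ ≃+* ℂ) (ρ : Literature.NumberTheory.GaloisRepresentations.FramedGaloisRep K (PadicAlgCl ℓ) n), ρ.toGaloisRep.IsIrreducible → ((∀ᶠ v : IsDedekindDomain.HeightOneSpectrum (NumberField.RingOfIntegers K) in Filter.cofinite, ρ.IsUnramifiedAt v) ∧ ∀ (v : IsDedekindDomain.HeightOneSpectrum (NumberField.RingOfIntegers K)) (hv : ((ℓ : ℕ) : NumberField.RingOfIntegers K) ∈ v.asIdeal), (Literature.NumberTheory.PAdicHodge.fontainePstAdicCompletion v ℓ hv).IsDeRhamFramed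 (ρ.toLocal v)) → (∃ (d : ℕ) (X : Literature.AlgebraicGeometry.Motives.SchemeOver K), Literature.AlgebraicGeometry.Motives.IsSmoothProjective d X ∧ ∃ (j : ℤ) (W : Submodule (PadicAlgCl ℓ) (TensorProduct ℚ_[ℓ] (PadicAlgCl ℓ) (Literature.AlgebraicGeometry.Motives.ellAdicEtaleCohomologyRat ℓ 1 (Literature.AlgebraicGeometry.Motives.geometricFibre K X)))) (hW : ∀ (g : Field.absoluteGaloisGroup K) (w : TensorProduct ℚ_[ℓ] (PadicAlgCl ℓ) (Literature.AlgebraicGeometry.Motives.ellAdicEtaleCohomologyRat ℓ 1 (Literature.AlgebraicGeometry.Motives.geometricFibre K X))), w ∈ W → (algebraMap ℚ_[ℓ] (PadicAlgCl ℓ) ((Literature.AlgebraicGeometry.Motives.padicCyclotomicCharacter K ℓ g : ℚ_[ℓ]ˣ) : ℚ_[ℓ])) ^ j • (Literature.AlgebraicGeometry.Motives.geometricEllAdicEtaleCohomologyRepRat ℓ X 1 g).baseChange (PadicAlgCl ℓ) w ∈ W) (f : W →ₗ[PadicAlgCl ℓ] (Fin n → PadicAlgCl ℓ)), Function.Surjective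 f ∧ ∀ (g : Field.absoluteGaloisGroup K) (w : W), f ⟨(algebraMap ℚ_[ℓ] (PadicAlgCl ℓ) ((Literature.AlgebraicGeometry.Motives.padicCyclotomicCharacter K ℓ g : ℚ_[ℓ]ˣ) : ℚ_[ℓ])) ^ j • (Literature.AlgebraicGeometry.Motives.geometricEllAdicEtaleCohomologyRepRat ℓ X 1 g).baseChange (PadicAlgCl ℓ) (w : TensorProduct ℚ_[ℓ] (PadicAlgCl ℓ) (Literature.AlgebraicGeometry.Motives.ellAdicEtaleCohomologyRat ℓ 1 (Literature.AlgebraicGeometry.Motives.geometricFibre K X))), hW g w w.2⟩ = ((ρ g : GL (Fin n) (PadicAlgCl ℓ)) : Matrix (Fin n) (Fin n) (PadicAlgCl ℓ)).mulVec (f w)) → ¬ (∀ (v : IsDedekindDomain.HeightOneSpectrum (NumberField.RingOfIntegers K)) (hv : ((ℓ : ℕ) : NumberField.RingOfIntegers K) ∈ v.asIdeal) (τ : v.adicCompletion K →+* PadicAlgCl ℓ), Continuous τ → ∀ w : ℤ, (ρ.labelledHodgeTateWeightsAt v (Literature.NumberTheory.PAdicHodge.fontainePstAdicCompletion v ℓ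 hv).algebra (Literature.NumberTheory.PAdicHodge.fontainePstAdicCompletion v ℓ hv).𝔅 τ).count w ≤ 1) → (∀ (v : IsDedekindDomain.HeightOneSpectrum (NumberField.RingOfIntegers K)) (hv : ((ℓ : ℕ) : NumberField.RingOfIntegers K) ∈ v.asIdeal) (τ : v.adicCompletion K →+* PadicAlgCl ℓ), Continuous τ → ∀ w : ℤ, (ρ.labelledHodgeTateWeightsAt v (Literature.NumberTheory.PAdicHodge.fontainePstAdicCompletion v ℓ hv).algebra (Literature.NumberTheory.PAdicHodge.fontainePstAdicCompletion v ℓ hv).𝔅 τ).count w ≤ 2) → (∃ (K₀ : Type) (_ : Field K₀) (_ : NumberField K₀) (M : Type) (_ : Field M) (_ : NumberField M) (_ : Algebra K M) (_ : Algebra K₀ M), (NumberField.IsTotallyReal K₀ ∨ NumberField.IsCMField K₀) ∧ (∃ (N : Type) (_ : Field N) (_ : NumberField N) (_ : Algebra K N) (_ : Algebra M N) (_ : IsScalarTower K M N), IsGalois K N ∧ IsSolvable (N ≃ₐ[K] N)) ∧ (∃ (N : Type) (_ : Field N) (_ : NumberField N) (_ : Algebra K₀ N) (_ : Algebra M N)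 (_ : IsScalarTower K₀ M N), IsGalois K₀ N ∧ IsSolvable (N ≃ₐ[K₀] N)) ∧ ∃ ρ₀ : Literature.NumberTheory.GaloisRepresentations.FramedGaloisRep K₀ (PadicAlgCl ℓ) n, ρ₀.toGaloisRep.IsIrreducible ∧ ((∀ᶠ v : IsDedekindDomain.HeightOneSpectrum (NumberField.RingOfIntegers K₀) in Filter.cofinite, ρ₀.IsUnramifiedAt v) ∧ ∀ (v : IsDedekindDomain.HeightOneSpectrum (NumberField.RingOfIntegers K₀)) (hv : ((ℓ : ℕ) : NumberField.RingOfIntegers K₀) ∈ v.asIdeal), (Literature.NumberTheory.PAdicHodge.fontainePstAdicCompletion v ℓ hv).IsDeRhamFramed (ρ₀.toLocal v)) ∧ ∀ g : Field.absoluteGaloisGroup M, ∃ c : PadicAlgCl ℓ, c ≠ 0 ∧ Literature.NumberTheory.GaloisRepresentations.FramedRep.charpoly (ρ.restrictField M) g = (Literature.NumberTheory.GaloisRepresentations.FramedRep.charpoly (ρ₀.restrictField M) g).scaleRoots c) → ∃ π : Literature.NumberTheory.Automorphic.CuspidalAutomorphicRepData n K hcpt, π.1.IsLAlgebraic ∧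 ∀ᶠ v : IsDedekindDomain.HeightOneSpectrum (NumberField.RingOfIntegers K) in Filter.cofinite, Summit.Langlands.SatakeFrobCompatibleAt ι π.1 ρ v

/-- DEBTVIS₁ `VisibleWeightOneInsolubleReciprocity` — DECLARED RESIDUAL (rank 4) · [S-implied · WEAKER · BARRIER (TaylorWiles
NumericalCoincidence l₀ = r₂ > 0 with no polarized descent; ShimuraVarietyRealization; SolvableImage for the base-change part)]:
AVR VERBATIM + «(mult ≤ 2) → ¬ (solvably of TR/CM type) →».  The visible weight-one pieces (rank ≤ 4 mod the door) that are NOT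
in the solvable orbit of any TR/CM datum.  VACUOUS over every totally real or CM base field (kernel
`visibleInsoluble_holds_over_TRCM`: K₀ = M = K, ρ₀ = ρ, c_g = 1), so it lives exactly over fields with a complex place that are
not CM, and there it is the union of two debts (birth split by the third-layer dial PSAT): the INSOLUBLE BASE-CHANGE debt
(ρ_E|Γ_K for E/ℚ and K = ℚ(β), β⁵ − β − 1 = 0, group S₅, signature (1,2): the weight-2 newform f_E has no known base change to K —
non-solvable base change off totally real targets is open even for GL₂) and the PRIMITIVE MIXED-SIGNATURE debt (E′ over the cubic
field of discriminant −23 with potentially multiplicative reduction at exactly one prime above 59 — g5's box: no TR/CM descent, no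
Galois representations attached to GL₂/K-forms, Calegari–Geraghty patching conditional on torsion classes).  The one print
engine touching it: Weil restriction to an index-2 totally real subfield + GSp₄ potential automorphy (BCGP 2018 Thm: elliptic curves
over quadratic extensions of totally real fields are POTENTIALLY modular) — potential only, [K : K⁺-type subfield] = 2 only. -/
def VisibleWeightOneInsolubleReciprocity : Prop :=
  ∀ (K : Type) [Field K] [NumberField K] (n : ℕ) (hcpt : Literature.NumberTheory.Automorphic.isCompact_glFiniteIntegralLevel n K), 0 < n → ∀ (ℓ : ℕ) [Fact ℓ.Prime] (ι : PadicAlgCl ℓ ≃+* ℂ) (ρ : Literature.NumberTheory.GaloisRepresentations.FramedGaloisRep K (PadicAlgCl ℓ) n), ρ.toGaloisRep.IsIrreducible → ((∀ᶠ v : IsDedekindDomain.HeightOneSpectrum (NumberField.RingOfIntegers K) in Filter.cofinite, ρ.IsUnramifiedAt v) ∧ ∀ (v : IsDedekindDomain.HeightOneSpectrum (NumberField.RingOfIntegers K)) (hv : ((ℓ : ℕ) : NumberField.RingOfIntegers K) ∈ v.asIdeal), (Literature.NumberTheory.PAdicHodge.fontainePstAdicCompletion v ℓ hv).IsDeRhamFramed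 (ρ.toLocal v)) → (∃ (d : ℕ) (X : Literature.AlgebraicGeometry.Motives.SchemeOver K), Literature.AlgebraicGeometry.Motives.IsSmoothProjective d X ∧ ∃ (j : ℤ) (W : Submodule (PadicAlgCl ℓ) (TensorProduct ℚ_[ℓ] (PadicAlgCl ℓ) (Literature.AlgebraicGeometry.Motives.ellAdicEtaleCohomologyRat ℓ 1 (Literature.AlgebraicGeometry.Motives.geometricFibre K X)))) (hW : ∀ (g : Field.absoluteGaloisGroup K) (w : TensorProduct ℚ_[ℓ] (PadicAlgCl ℓ) (Literature.AlgebraicGeometry.Motives.ellAdicEtaleCohomologyRat ℓ 1 (Literature.AlgebraicGeometry.Motives.geometricFibre K X))), w ∈ W → (algebraMap ℚ_[ℓ] (PadicAlgCl ℓ) ((Literature.AlgebraicGeometry.Motives.padicCyclotomicCharacter K ℓ g : ℚ_[ℓ]ˣ) : ℚ_[ℓ])) ^ j • (Literature.AlgebraicGeometry.Motives.geometricEllAdicEtaleCohomologyRepRat ℓ X 1 g).baseChange (PadicAlgCl ℓ) w ∈ W) (f : W →ₗ[PadicAlgCl ℓ] (Fin n → PadicAlgCl ℓ)), Function.Surjective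 f ∧ ∀ (g : Field.absoluteGaloisGroup K) (w : W), f ⟨(algebraMap ℚ_[ℓ] (PadicAlgCl ℓ) ((Literature.AlgebraicGeometry.Motives.padicCyclotomicCharacter K ℓ g : ℚ_[ℓ]ˣ) : ℚ_[ℓ])) ^ j • (Literature.AlgebraicGeometry.Motives.geometricEllAdicEtaleCohomologyRepRat ℓ X 1 g).baseChange (PadicAlgCl ℓ) (w : TensorProduct ℚ_[ℓ] (PadicAlgCl ℓ) (Literature.AlgebraicGeometry.Motives.ellAdicEtaleCohomologyRat ℓ 1 (Literature.AlgebraicGeometry.Motives.geometricFibre K X))), hW g w w.2⟩ = ((ρ g : GL (Fin n) (PadicAlgCl ℓ)) : Matrix (Fin n) (Fin n) (PadicAlgCl ℓ)).mulVec (f w)) → (∀ (v : IsDedekindDomain.HeightOneSpectrum (NumberField.RingOfIntegers K)) (hv : ((ℓ : ℕ) : NumberField.RingOfIntegers K) ∈ v.asIdeal) (τ : v.adicCompletion K →+* PadicAlgCl ℓ), Continuous τ → ∀ w : ℤ, (ρ.labelledHodgeTateWeightsAt v (Literature.NumberTheory.PAdicHodge.fontainePstAdicCompletion v ℓ hv).algebra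 (Literature.NumberTheory.PAdicHodge.fontainePstAdicCompletion v ℓ hv).𝔅 τ).count w ≤ 2) → ¬ (∃ (K₀ : Type) (_ : Field K₀) (_ : NumberField K₀) (M : Type) (_ : Field M) (_ : NumberField M) (_ : Algebra K M) (_ : Algebra K₀ M), (NumberField.IsTotallyReal K₀ ∨ NumberField.IsCMField K₀) ∧ (∃ (N : Type) (_ : Field N) (_ : NumberField N) (_ : Algebra K N) (_ : Algebra M N) (_ : IsScalarTower K M N), IsGalois K N ∧ IsSolvable (N ≃ₐ[K] N)) ∧ (∃ (N : Type) (_ : Field N) (_ : NumberField N) (_ : Algebra K₀ N) (_ : Algebra M N) (_ : IsScalarTower K₀ M N), IsGalois K₀ N ∧ IsSolvable (N ≃ₐ[K₀] N)) ∧ ∃ ρ₀ : Literature.NumberTheory.GaloisRepresentations.FramedGaloisRep K₀ (PadicAlgCl ℓ) n, ρ₀.toGaloisRep.IsIrreducible ∧ ((∀ᶠ v : IsDedekindDomain.HeightOneSpectrum (NumberField.RingOfIntegers K₀) in Filter.cofinite, ρ₀.IsUnramifiedAt v) ∧ ∀ (v : IsDedekindDomain.HeightOneSpectrum (NumberField.RingOfIntegers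 K₀)) (hv : ((ℓ : ℕ) : NumberField.RingOfIntegers K₀) ∈ v.asIdeal), (Literature.NumberTheory.PAdicHodge.fontainePstAdicCompletion v ℓ hv).IsDeRhamFramed (ρ₀.toLocal v)) ∧ ∀ g : Field.absoluteGaloisGroup M, ∃ c : PadicAlgCl ℓ, c ≠ 0 ∧ Literature.NumberTheory.GaloisRepresentations.FramedRep.charpoly (ρ.restrictField M) g = (Literature.NumberTheory.GaloisRepresentations.FramedRep.charpoly (ρ₀.restrictField M) g).scaleRoots c) → ∃ π : Literature.NumberTheory.Automorphic.CuspidalAutomorphicRepData n K hcpt, π.1.IsLAlgebraic ∧ ∀ᶠ v : IsDedekindDomain.HeightOneSpectrum (NumberField.RingOfIntegers K) in Filter.cofinite, Summit.Langlands.SatakeFrobCompatibleAt ι π.1 ρ v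

/- DEG₁ = g34's cell `WeightOneVisibilitySplit.DegenerateWeightOneReciprocity` (LANDED, p831697; sha12 of the statement text 8cf5a646d7da) —
   the fourth binder of `closes_target`, used BY NAME (declared residual, rank 5, in the would-be child route V-W-D). -/

/-! ### Node-only statements (never items) -/

/- REG₁ / WALL₁ = g34's cells `WeightOneVisibilitySplit.RegularWeightOneReciprocity` / `.WallWeightOneReciprocity` (LANDED) — BY NAME. -/

/-- DEBTVIS₁ read at ONE base field `K` (the three `K`-binders dropped) — for the TR/CM vacuity certificate. -/
def VisibleWeightOneInsolubleReciprocityAt (K : Type) [Field K] [NumberField K] : Prop :=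
  ∀ (n : ℕ) (hcpt : Literature.NumberTheory.Automorphic.isCompact_glFiniteIntegralLevel n K), 0 < n → ∀ (ℓ : ℕ) [Fact ℓ.Prime] (ι : PadicAlgCl ℓ ≃+* ℂ) (ρ : Literature.NumberTheory.GaloisRepresentations.FramedGaloisRep K (PadicAlgCl ℓ) n), ρ.toGaloisRep.IsIrreducible → ((∀ᶠ v : IsDedekindDomain.HeightOneSpectrum (NumberField.RingOfIntegers K) in Filter.cofinite, ρ.IsUnramifiedAt v) ∧ ∀ (v : IsDedekindDomain.HeightOneSpectrum (NumberField.RingOfIntegers K)) (hv : ((ℓ : ℕ) : NumberField.RingOfIntegers K) ∈ v.asIdeal), (Literature.NumberTheory.PAdicHodge.fontainePstAdicCompletion v ℓ hv).IsDeRhamFramed (ρ.toLocal v)) → (∃ (d : ℕ) (X : Literature.AlgebraicGeometry.Motives.SchemeOver K), Literature.AlgebraicGeometry.Motives.IsSmoothProjective d X ∧ ∃ (j : ℤ) (W : Submodule (PadicAlgCl ℓ) (TensorProduct ℚ_[ℓ] (PadicAlgCl ℓ) (Literature.AlgebraicGeometry.Motives.ellAdicEtaleCohomologyRat ℓ 1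 (Literature.AlgebraicGeometry.Motives.geometricFibre K X)))) (hW : ∀ (g : Field.absoluteGaloisGroup K) (w : TensorProduct ℚ_[ℓ] (PadicAlgCl ℓ) (Literature.AlgebraicGeometry.Motives.ellAdicEtaleCohomologyRat ℓ 1 (Literature.AlgebraicGeometry.Motives.geometricFibre K X))), w ∈ W → (algebraMap ℚ_[ℓ] (PadicAlgCl ℓ) ((Literature.AlgebraicGeometry.Motives.padicCyclotomicCharacter K ℓ g : ℚ_[ℓ]ˣ) : ℚ_[ℓ])) ^ j • (Literature.AlgebraicGeometry.Motives.geometricEllAdicEtaleCohomologyRepRat ℓ X 1 g).baseChange (PadicAlgCl ℓ) w ∈ W) (f : W →ₗ[PadicAlgCl ℓ] (Fin n → PadicAlgCl ℓ)), Function.Surjective f ∧ ∀ (g : Field.absoluteGaloisGroup K) (w : W), f ⟨(algebraMap ℚ_[ℓ] (PadicAlgCl ℓ) ((Literature.AlgebraicGeometry.Motives.padicCyclotomicCharacter K ℓ g : ℚ_[ℓ]ˣ) : ℚ_[ℓ])) ^ j • (Literature.AlgebraicGeometry.Motives.geometricEllAdicEtaleCohomologyRepRat ℓ X 1 g).baseChange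 (PadicAlgCl ℓ) (w : TensorProduct ℚ_[ℓ] (PadicAlgCl ℓ) (Literature.AlgebraicGeometry.Motives.ellAdicEtaleCohomologyRat ℓ 1 (Literature.AlgebraicGeometry.Motives.geometricFibre K X))), hW g w w.2⟩ = ((ρ g : GL (Fin n) (PadicAlgCl ℓ)) : Matrix (Fin n) (Fin n) (PadicAlgCl ℓ)).mulVec (f w)) → (∀ (v : IsDedekindDomain.HeightOneSpectrum (NumberField.RingOfIntegers K)) (hv : ((ℓ : ℕ) : NumberField.RingOfIntegers K) ∈ v.asIdeal) (τ : v.adicCompletion K →+* PadicAlgCl ℓ), Continuous τ → ∀ w : ℤ, (ρ.labelledHodgeTateWeightsAt v (Literature.NumberTheory.PAdicHodge.fontainePstAdicCompletion v ℓ hv).algebra (Literature.NumberTheory.PAdicHodge.fontainePstAdicCompletion v ℓ hv).𝔅 τ).count w ≤ 2) → ¬ (∃ (K₀ : Type) (_ : Field K₀) (_ : NumberField K₀) (M : Type) (_ : Field M) (_ : NumberField M) (_ : Algebra K M) (_ : Algebra K₀ M), (NumberField.IsTotallyReal K₀ ∨ NumberField.IsCMField K₀) ∧ (∃ (N : Type)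 (_ : Field N) (_ : NumberField N) (_ : Algebra K N) (_ : Algebra M N) (_ : IsScalarTower K M N), IsGalois K N ∧ IsSolvable (N ≃ₐ[K] N)) ∧ (∃ (N : Type) (_ : Field N) (_ : NumberField N) (_ : Algebra K₀ N) (_ : Algebra M N) (_ : IsScalarTower K₀ M N), IsGalois K₀ N ∧ IsSolvable (N ≃ₐ[K₀] N)) ∧ ∃ ρ₀ : Literature.NumberTheory.GaloisRepresentations.FramedGaloisRep K₀ (PadicAlgCl ℓ) n, ρ₀.toGaloisRep.IsIrreducible ∧ ((∀ᶠ v : IsDedekindDomain.HeightOneSpectrum (NumberField.RingOfIntegers K₀) in Filter.cofinite, ρ₀.IsUnramifiedAt v) ∧ ∀ (v : IsDedekindDomain.HeightOneSpectrum (NumberField.RingOfIntegers K₀)) (hv : ((ℓ : ℕ) : NumberField.RingOfIntegers K₀) ∈ v.asIdeal), (Literature.NumberTheory.PAdicHodge.fontainePstAdicCompletion v ℓ hv).IsDeRhamFramed (ρ₀.toLocal v)) ∧ ∀ g : Field.absoluteGaloisGroup M, ∃ c : PadicAlgCl ℓ, c ≠ 0 ∧ Literature.NumberTheory.GaloisRepresentations.FramedRep.charpoly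 (ρ.restrictField M) g = (Literature.NumberTheory.GaloisRepresentations.FramedRep.charpoly (ρ₀.restrictField M) g).scaleRoots c) → ∃ π : Literature.NumberTheory.Automorphic.CuspidalAutomorphicRepData n K hcpt, π.1.IsLAlgebraic ∧ ∀ᶠ v : IsDedekindDomain.HeightOneSpectrum (NumberField.RingOfIntegers K) in Filter.cofinite, Summit.Langlands.SatakeFrobCompatibleAt ι π.1 ρ v

/-! ### Kernel 1: the deciding composition and the exact four-cell partition of AVR (pure logic: excluded middle on the
two dials, pointwise; 0 EQUIV, no W⁺, no sibling item) -/

/-- THE DECIDING THEOREM of the node: SATREG₁ → SATWALL₁ → DEBTVIS₁ → DEG₁ → AVR (target BY NAME; all four binders consumed). -/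
theorem closes_target (hSR : RegularWeightOneTRCMReciprocity) (hSW : WallWeightOneTRCMReciprocity)
    (hDV : VisibleWeightOneInsolubleReciprocity) (hD : Summit.Langlands.Langlands.Theorems.WeightOneVisibilitySplit.DegenerateWeightOneReciprocity) :
    Summit.Langlands.Langlands.Theses.MotivicDictionarySplit.AbelianMotivicReciprocity :=
  fun K _ _ n hcpt hn ℓ _ ι ρ hirr hgeom hmot => by
    by_cases h2 : Summit.Langlands.Langlands.Theorems.WeightOneVisibilitySplit.HasLabelledHTMultiplicityAtMost K ℓ n ρ 2
    · by_cases hs : IsSolvablyOfTRCMType K ℓ n ρ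
      · by_cases h1 : Summit.Langlands.Langlands.Theorems.WeightOneVisibilitySplit.HasLabelledHTMultiplicityAtMost K ℓ n ρ 1
        · exact hSR K n hcpt hn ℓ ι ρ hirr hgeom hmot h1 hs
        · exact hSW K n hcpt hn ℓ ι ρ hirr hgeom hmot h1 h2 hs
      · exact hDV K n hcpt hn ℓ ι ρ hirr hgeom hmot h2 hs
    · exact hD K n hcpt hn ℓ ι ρ hirr hgeom hmot h2

/-- AVR ⟹ SATREG₁ (restriction). -/
theorem satRegular_of_target (h : Summit.Langlands.Langlands.Theses.MotivicDictionarySplit.AbelianMotivicReciprocity) :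
    RegularWeightOneTRCMReciprocity :=
  fun K _ _ n hcpt hn ℓ _ ι ρ hirr hgeom hmot _ _ => h K n hcpt hn ℓ ι ρ hirr hgeom hmot

/-- AVR ⟹ SATWALL₁ (restriction). -/
theorem satWall_of_target (h : Summit.Langlands.Langlands.Theses.MotivicDictionarySplit.AbelianMotivicReciprocity) :
    WallWeightOneTRCMReciprocity :=
  fun K _ _ n hcpt hn ℓ _ ι ρ hirr hgeom hmot _ _ _ => h K n hcpt hn ℓ ι ρ hirr hgeom hmot

/-- AVR ⟹ DEBTVIS₁ (restriction). -/
theorem visibleInsoluble_of_target (h : Summit.Langlands.Langlands.Theses.MotivicDictionarySplit.AbelianMotivicReciprocity) :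
    VisibleWeightOneInsolubleReciprocity :=
  fun K _ _ n hcpt hn ℓ _ ι ρ hirr hgeom hmot _ _ => h K n hcpt hn ℓ ι ρ hirr hgeom hmot

/-- EXACTNESS: AVR ⟺ SATREG₁ ∧ SATWALL₁ ∧ DEBTVIS₁ ∧ DEG₁ — the node adds no content beyond AVR and loses none. -/
theorem abelianMotivicReciprocity_iff_cells :
    Summit.Langlands.Langlands.Theses.MotivicDictionarySplit.AbelianMotivicReciprocity ↔
      (RegularWeightOneTRCMReciprocity ∧ WallWeightOneTRCMReciprocity ∧
        VisibleWeightOneInsolubleReciprocity ∧ Summit.Langlands.Langlands.Theorems.WeightOneVisibilitySplit.DegenerateWeightOneReciprocity) :=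
  ⟨fun h => ⟨satRegular_of_target h, satWall_of_target h, visibleInsoluble_of_target h, Summit.Langlands.Langlands.Theorems.WeightOneVisibilitySplit.degenerate_of_target h⟩,
   fun h => closes_target h.1 h.2.1 h.2.2.1 h.2.2.2⟩

/-! ### Kernel 2: second layer of g34 — the visible hull REG₁ ∧ WALL₁ is EXACTLY the three new cells -/

/-- REG₁ ⟸ SATREG₁ ∧ DEBTVIS₁. -/
theorem regularWeightOne_of_cells (hSR : RegularWeightOneTRCMReciprocity) (hDV : VisibleWeightOneInsolubleReciprocity) :
    Summit.Langlands.Langlands.Theorems.WeightOneVisibilitySplit.RegularWeightOneReciprocity :=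
  fun K _ _ n hcpt hn ℓ _ ι ρ hirr hgeom hmot h1 => by
    by_cases hs : IsSolvablyOfTRCMType K ℓ n ρ
    · exact hSR K n hcpt hn ℓ ι ρ hirr hgeom hmot h1 hs
    · exact hDV K n hcpt hn ℓ ι ρ hirr hgeom hmot (Summit.Langlands.Langlands.Theorems.WeightOneVisibilitySplit.hasLabelledHTMultiplicityAtMost_mono K ℓ n ρ one_le_two h1) hs

/-- WALL₁ ⟸ SATWALL₁ ∧ DEBTVIS₁. -/
theorem wallWeightOne_of_cells (hSW : WallWeightOneTRCMReciprocity) (hDV : VisibleWeightOneInsolubleReciprocity) :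
    Summit.Langlands.Langlands.Theorems.WeightOneVisibilitySplit.WallWeightOneReciprocity :=
  fun K _ _ n hcpt hn ℓ _ ι ρ hirr hgeom hmot h1 h2 => by
    by_cases hs : IsSolvablyOfTRCMType K ℓ n ρ
    · exact hSW K n hcpt hn ℓ ι ρ hirr hgeom hmot h1 h2 hs
    · exact hDV K n hcpt hn ℓ ι ρ hirr hgeom hmot h2 hs

/-- REG₁ ∧ WALL₁ ⟹ the three new cells (restrictions; DEBTVIS₁ by cases on the first dial). -/
theorem cells_of_visible (hR : Summit.Langlands.Langlands.Theorems.WeightOneVisibilitySplit.RegularWeightOneReciprocity) (hW : Summit.Langlands.Langlands.Theorems.WeightOneVisibilitySplit.WallWeightOneReciprocity) :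
    RegularWeightOneTRCMReciprocity ∧ WallWeightOneTRCMReciprocity ∧ VisibleWeightOneInsolubleReciprocity :=
  ⟨fun K _ _ n hcpt hn ℓ _ ι ρ hirr hgeom hmot h1 _ => hR K n hcpt hn ℓ ι ρ hirr hgeom hmot h1,
   fun K _ _ n hcpt hn ℓ _ ι ρ hirr hgeom hmot h1 h2 _ => hW K n hcpt hn ℓ ι ρ hirr hgeom hmot h1 h2,
   fun K _ _ n hcpt hn ℓ _ ι ρ hirr hgeom hmot h2 _ => by
     by_cases h1 : Summit.Langlands.Langlands.Theorems.WeightOneVisibilitySplit.HasLabelledHTMultiplicityAtMost K ℓ n ρ 1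
     · exact hR K n hcpt hn ℓ ι ρ hirr hgeom hmot h1
     · exact hW K n hcpt hn ℓ ι ρ hirr hgeom hmot h1 h2⟩

/-- EXACTNESS of the second layer: (REG₁ ∧ WALL₁) ⟺ (SATREG₁ ∧ SATWALL₁ ∧ DEBTVIS₁). With g34's
`abelianMotivicReciprocity_iff_cells` (AVR ⟺ REG₁ ∧ WALL₁ ∧ DEG₁) this is the lattice identity behind `closes_target`. -/
theorem visible_iff_cells :
    (Summit.Langlands.Langlands.Theorems.WeightOneVisibilitySplit.RegularWeightOneReciprocity ∧ Summit.Langlands.Langlands.Theorems.WeightOneVisibilitySplit.WallWeightOneReciprocity) ↔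
      (RegularWeightOneTRCMReciprocity ∧ WallWeightOneTRCMReciprocity ∧ VisibleWeightOneInsolubleReciprocity) :=
  ⟨fun h => cells_of_visible h.1 h.2,
   fun h => ⟨regularWeightOne_of_cells h.1 h.2.2, wallWeightOne_of_cells h.2.1 h.2.2⟩⟩

/-- JUNCTION with g34's LANDED deciding theorem `WeightOneVisibilitySplit.closes_target` (REG₁ → WALL₁ → DEG₁ → AVR, p831697):
the four g35 cells give AVR THROUGH g34's three chambers (so the g35 cells refine g34's, never coarsen them). -/
theorem closes_target_via_g34 (hSR : RegularWeightOneTRCMReciprocity) (hSW : WallWeightOneTRCMReciprocity)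
    (hDV : VisibleWeightOneInsolubleReciprocity) (hD : Summit.Langlands.Langlands.Theorems.WeightOneVisibilitySplit.DegenerateWeightOneReciprocity) :
    Summit.Langlands.Langlands.Theses.MotivicDictionarySplit.AbelianMotivicReciprocity :=
  Summit.Langlands.Langlands.Theorems.WeightOneVisibilitySplit.closes_target (regularWeightOne_of_cells hSR hDV) (wallWeightOne_of_cells hSW hDV) hD

/-- The same lattice identity read with g34's LANDED exactness `WeightOneVisibilitySplit.abelianMotivicReciprocity_iff_cells`
(AVR ⟺ REG₁ ∧ WALL₁ ∧ DEG₁): AVR ⟺ (SATREG₁ ∧ SATWALL₁ ∧ DEBTVIS₁) ∧ DEG₁, via `visible_iff_cells`. -/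
theorem abelianMotivicReciprocity_iff_cells_via_g34 :
    Summit.Langlands.Langlands.Theses.MotivicDictionarySplit.AbelianMotivicReciprocity ↔
      ((RegularWeightOneTRCMReciprocity ∧ WallWeightOneTRCMReciprocity ∧ VisibleWeightOneInsolubleReciprocity) ∧
        Summit.Langlands.Langlands.Theorems.WeightOneVisibilitySplit.DegenerateWeightOneReciprocity) :=
  Summit.Langlands.Langlands.Theorems.WeightOneVisibilitySplit.abelianMotivicReciprocity_iff_cells.trans
    ⟨fun h => ⟨visible_iff_cells.mp ⟨h.1, h.2.1⟩, h.2.2⟩, fun h => ⟨(visible_iff_cells.mpr h.1).1, (visible_iff_cells.mpr h.1).2, h.2⟩⟩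

/-! ### Kernel 3: the residual has NO content over totally real or CM base fields -/

/-- SAT ⟹ PSAT (forget the solvability of `M/K₀`). -/
theorem isPotentiallyOfTRCMType_of_isSolvably (K : Type) [Field K] [NumberField K] (ℓ : ℕ) [Fact ℓ.Prime] (n : ℕ)
    (ρ : Literature.NumberTheory.GaloisRepresentations.FramedGaloisRep K (PadicAlgCl ℓ) n)
    (h : IsSolvablyOfTRCMType K ℓ n ρ) : IsPotentiallyOfTRCMType K ℓ n ρ := by
  obtain ⟨K₀, iF, iN, M, iFM, iNM, iA, iA₀, hK₀, hKM, _, ρ₀, hrest⟩ := h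
  exact ⟨K₀, iF, iN, M, iFM, iNM, iA, iA₀, hK₀, hKM, ρ₀, hrest⟩

/-- Over a totally real or CM `K`, EVERY irreducible pinned-geometric `ρ` is solvably of TR/CM type
(`K₀ = M = K`, `ρ₀ = ρ`, `c_g = 1`): TR/CM content cannot be moved into the residual. -/
theorem isSolvablyOfTRCMType_of_isTRorCM (K : Type) [Field K] [NumberField K] (ℓ : ℕ) [Fact ℓ.Prime] (n : ℕ)
    (ρ : Literature.NumberTheory.GaloisRepresentations.FramedGaloisRep K (PadicAlgCl ℓ) n)
    (hK : NumberField.IsTotallyReal K ∨ NumberField.IsCMField K) (hirr : ρ.toGaloisRep.IsIrreducible)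
    (hgeom : ((∀ᶠ v : IsDedekindDomain.HeightOneSpectrum (NumberField.RingOfIntegers K) in Filter.cofinite, ρ.IsUnramifiedAt v) ∧ ∀ (v : IsDedekindDomain.HeightOneSpectrum (NumberField.RingOfIntegers K)) (hv : ((ℓ : ℕ) : NumberField.RingOfIntegers K) ∈ v.asIdeal), (Literature.NumberTheory.PAdicHodge.fontainePstAdicCompletion v ℓ hv).IsDeRhamFramed (ρ.toLocal v))) :
    IsSolvablyOfTRCMType K ℓ n ρ :=
  ⟨K, inferInstance, inferInstance, K, inferInstance, inferInstance, inferInstance, inferInstance, hK,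
    ⟨K, inferInstance, inferInstance, inferInstance, inferInstance, inferInstance, inferInstance, inferInstance⟩,
    ⟨K, inferInstance, inferInstance, inferInstance, inferInstance, inferInstance, inferInstance, inferInstance⟩,
    ρ, hirr, hgeom, fun _ => ⟨1, one_ne_zero, (Polynomial.scaleRoots_one _).symm⟩⟩

/-- `Iff.rfl` certificate: the fixed-field reading is DEBTVIS₁'s body. -/
theorem visibleInsoluble_iff_at :
    VisibleWeightOneInsolubleReciprocity ↔ ∀ (K : Type) [Field K] [NumberField K], VisibleWeightOneInsolubleReciprocityAt K :=
  Iff.rfl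

/-- DEBTVIS₁ HOLDS OUTRIGHT over every totally real or CM base field (its dial hypothesis is contradictory there):
the residual lives exactly over number fields with a complex place that are not CM. -/
theorem visibleInsoluble_holds_over_TRCM (K : Type) [Field K] [NumberField K]
    (hK : NumberField.IsTotallyReal K ∨ NumberField.IsCMField K) : VisibleWeightOneInsolubleReciprocityAt K :=
  fun n _ _ ℓ _ _ ρ hirr hgeom _ _ hns =>
    absurd (isSolvablyOfTRCMType_of_isTRorCM K ℓ n ρ hK hirr hgeom) hns

/-! ### Kernel 4: S-implied certificates (each cell is a restriction of B_w = `PrimeSwitchSplit.WeakGeometricAutomorphy`, 17414) -/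

/-- S-implied certificate: the parent B_w gives SATREG₁ (drop the realisation and both guards). -/
theorem satRegular_of_weakGeometricAutomorphy
    (h : Summit.Langlands.Langlands.Theses.PrimeSwitchSplit.WeakGeometricAutomorphy) : RegularWeightOneTRCMReciprocity :=
  fun K _ _ n hcpt hn ℓ _ ι ρ hirr hgeom _ _ _ => h K n hcpt hn ℓ ι ρ hirr hgeom

/-- S-implied certificate: B_w gives SATWALL₁. -/
theorem satWall_of_weakGeometricAutomorphy
    (h : Summit.Langlands.Langlands.Theses.PrimeSwitchSplit.WeakGeometricAutomorphy) : WallWeightOneTRCMReciprocity :=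
  fun K _ _ n hcpt hn ℓ _ ι ρ hirr hgeom _ _ _ _ => h K n hcpt hn ℓ ι ρ hirr hgeom

/-- S-implied certificate: B_w gives DEBTVIS₁ (so a refutation of the residual refutes B_w and `Langlands`). -/
theorem visibleInsoluble_of_weakGeometricAutomorphy
    (h : Summit.Langlands.Langlands.Theses.PrimeSwitchSplit.WeakGeometricAutomorphy) : VisibleWeightOneInsolubleReciprocity :=
  fun K _ _ n hcpt hn ℓ _ ι ρ hirr hgeom _ _ _ => h K n hcpt hn ℓ ι ρ hirr hgeom

/-! ### Kernel 5: through the parent and to the root (landed `MotivicDictionarySplit.closes`, `PrimeSwitchSplit.closes`) -/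

/-- + HMR (27426) + NMR (27427) ⟹ B_w (17414). -/
theorem closes_parent (hSR : RegularWeightOneTRCMReciprocity) (hSW : WallWeightOneTRCMReciprocity)
    (hDV : VisibleWeightOneInsolubleReciprocity) (hD : Summit.Langlands.Langlands.Theorems.WeightOneVisibilitySplit.DegenerateWeightOneReciprocity)
    (hH : Summit.Langlands.Langlands.Theses.MotivicDictionarySplit.HigherMotivicReciprocity)
    (hN : Summit.Langlands.Langlands.Theses.MotivicDictionarySplit.NonMotivicReciprocity) :
    Summit.Langlands.Langlands.Theses.PrimeSwitchSplit.WeakGeometricAutomorphy :=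
  Summit.Langlands.Langlands.Theses.MotivicDictionarySplit.closes (closes_target hSR hSW hDV hD) hH hN

/-- ROOT: … and with N0's other five items the pieces decide `Langlands`. -/
theorem closes_root (hSR : RegularWeightOneTRCMReciprocity) (hSW : WallWeightOneTRCMReciprocity)
    (hDV : VisibleWeightOneInsolubleReciprocity) (hD : Summit.Langlands.Langlands.Theorems.WeightOneVisibilitySplit.DegenerateWeightOneReciprocity)
    (hH : Summit.Langlands.Langlands.Theses.MotivicDictionarySplit.HigherMotivicReciprocity)
    (hN : Summit.Langlands.Langlands.Theses.MotivicDictionarySplit.NonMotivicReciprocity)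
    (hW' : Summit.Langlands.Langlands.Theses.PrimeSwitchSplit.SatakeAvatarExistence)
    (hP : Summit.Langlands.Langlands.Theses.PrimeSwitchSplit.PadicMemberCompatibility)
    (hAw : Summit.Langlands.Langlands.Theses.PrimeSwitchSplit.CompatibilityAwayFromLR)
    (hRd : Summit.Langlands.Langlands.Theses.PrimeSwitchSplit.CanonicalReciprocityData)
    (hU : Summit.Langlands.Langlands.Theses.PrimeSwitchSplit.AvatarConjugacy) : _root_.Langlands :=
  Summit.Langlands.Langlands.Theses.PrimeSwitchSplit.closes (closes_parent hSR hSW hDV hD hH hN) hW' hP hAw hRd hU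

#print axioms closes_target
#print axioms abelianMotivicReciprocity_iff_cells
#print axioms visible_iff_cells
#print axioms closes_target_via_g34
#print axioms visibleInsoluble_holds_over_TRCM
#print axioms closes_parent
#print axioms closes_root

end Summit.Langlands.Langlands.Theorems.WeightOneDescentSplit
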